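import Summits.BirchSwinnertonDyer.BirchSwinnertonDyer.Theorems.Rank2ObservatoryRank3AlgebraicData
import Summits.BirchSwinnertonDyer.BirchSwinnertonDyer.Theorems.Rank2ObservatoryRank3CensusCurves
import HarnessLib

/-!
# BirchSwinnertonDyer — rank ≥ 2 observatory: ONE-STOP algebraic BSD data of the rank-3 census WITH THE EXACT RANK (kernel)

HONEST FRAMING: per-curve certified theorems and census instruments; no claim on BSD in rank ≥ 2.

`Rank2ObservatoryRank3AlgebraicData` bundles, for every row of the rank-3 census table `rank3Table` (9 487 curves of
conductor `< 5·10⁵`), the kernel theorems: global minimality, `N_E = N`, `3 ≤ rank_ℤ E(ℚ)`, `#E(ℚ)_tors`, `∏_v c_v`.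
After the census AUDIT (`Rank2ObservatoryRank3CensusResidual`: the GRAND census `Rank3KernelRankCensusN9365` is EXACTLY
the table minus the 122 rows `Rank3CensusAudit.residualRows`), the rank component is upgraded to the EXACT rank
`rank_ℤ E(ℚ) = 3` for every row outside the residual list — still NO named fact and NO hypothesis — and, over the
whole table, with the 2-descent bound `rank_ℤ ≤ 3` asked only of the 122 residual rows:
* `Rank3Row.algebraicDataRank_getElem` (index form, all five components) / `Rank3Row.algebraicDataRank_of_mem`
  (membership form) / `…_of_label_not_mem` (label form) / `…_table` (whole table, `hup` for the residual rows only);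
* worked examples `algebraicDataRank_5077a1` (row `0`: the curve `y² + y = x³ − 7x + 6` of conductor `5077`:
  minimal, `N_E = 5077`, `rank_ℤ = 3`, `#E(ℚ)_tors = 1`, `∏ c_v = 1`) and `algebraicDataRank_431613a2` (row `7507`:
  `rank_ℤ = 3`, `#E(ℚ)_tors = 2`, `∏ c_v = 576`).
So everything on the algebraic side of the BSD formula except the regulator and `#Ш` — and now including the
Mordell–Weil rank itself — is ONE lemma per curve for 9 365 of the 9 487 census curves.  Sorry-free; no new axioms;
kernel `decide` only (no `native_decide`).
References: J. H. Silverman, *Advanced Topics in the Arithmetic of Elliptic Curves* (1994) IV.9–IV.11; J. H. Silverman,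
*The Arithmetic of Elliptic Curves* (2nd ed. 2009) VII.3.1, VIII.7; J. W. S. Cassels, *Lectures on Elliptic Curves*
(1991) §15; J. E. Cremona, *Algorithms for Modular Elliptic Curves* (2nd ed. 1997) §3.5, §3.6 and Tables.
-/

-- single-conjunct summit: `Summit.BirchSwinnertonDyer.BirchSwinnertonDyer.…` repeats the name by design
set_option linter.dupNamespace false
set_option autoImplicit false
-- deep literal lists behind the table definition: raise the recursion budget for the whole file
set_option maxRecDepth 400000

namespace Summit.BirchSwinnertonDyer.BirchSwinnertonDyer.Rank2Observatory

open Literature Literature.NumberTheory.EllipticCurves WeierstrassCurve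
open Rank3CensusAudit

/-- **ONE-STOP ALGEBRAIC BSD DATA of row `i` of the rank-3 table WITH THE EXACT RANK (NO named fact, NO hypothesis
beyond "not one of the 122 residual rows")**: global minimality, conductor, `rank_ℤ E(ℚ) = 3`, torsion order and
Tamagawa product, each a kernel theorem of the tree. [cite: Silverman1994, IV.9.4] [cite: SilvermanAEC2009, Prop. VII.3.1(b)]
[cite: Cassels1991LecturesEllipticCurves, §15] [cite: CremonaAlgorithms1997, Tables, §3.5, §3.6] -/
theorem Rank3Row.algebraicDataRank_getElem (i : ℕ) (hi : i < rank3Table.length)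
    (hn : rank3Table[i]'hi ∉ residualRows) :
    (rank3Table[i]'hi).curve.IsGloballyMinimal ∧
      (rank3Table[i]'hi).curve.conductorNorm ℤ = (rank3Table[i]'hi).N ∧
      (rank3Table[i]'hi).curve.mordellWeilRank = 3 ∧
      (rank3Table[i]'hi).curve.torsionOrder =
        rank3TorsValues[i]'(by rw [rank3TorsValues_length, ← rank3Table_length]; exact hi) ∧
      (rank3Table[i]'hi).curve.tamagawaProduct =
        Tam.rank3TamValues[i]'(by rw [Tam.rank3TamValues_length, ← rank3Table_length]; exact hi) := by
  obtain ⟨h₁, h₂, -, h₄, h₅⟩ := Rank3Row.algebraicData_getElem i hi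
  exact ⟨h₁, h₂, rank_eq_three_of_not_mem_residualRows (List.getElem_mem hi) hn, h₄, h₅⟩

/-- Membership form: minimal, `N_E = N` and `rank_ℤ E(ℚ) = 3` for every table row outside the 122 residual rows, NO
hypothesis. [cite: Silverman1994, IV.9.4] [cite: Cassels1991LecturesEllipticCurves, §15] -/
theorem Rank3Row.algebraicDataRank_of_mem {r : Rank3Row} (hr : r ∈ rank3Table) (hn : r ∉ residualRows) :
    r.curve.IsGloballyMinimal ∧ r.curve.conductorNorm ℤ = r.N ∧ r.curve.mordellWeilRank = 3 :=
  ⟨Rank3Row.isGloballyMinimal_of_mem hr, Rank3Row.conductorNorm_eq_of_mem hr,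
    rank_eq_three_of_not_mem_residualRows hr hn⟩

/-- Label form: the same for every table row whose Cremona label is not one of the 122 `residualLabels`.
[cite: Silverman1994, IV.9.4] [cite: CremonaAlgorithms1997, Tables, §3.5, §3.6] -/
theorem Rank3Row.algebraicDataRank_of_label_not_mem {r : Rank3Row} (hr : r ∈ rank3Table)
    (hl : r.label ∉ residualLabels) :
    r.curve.IsGloballyMinimal ∧ r.curve.conductorNorm ℤ = r.N ∧ r.curve.mordellWeilRank = 3 :=
  ⟨Rank3Row.isGloballyMinimal_of_mem hr, Rank3Row.conductorNorm_eq_of_mem hr, rank_eq_three_of_label_not_mem hr hl⟩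

/-- Whole-table form: minimal, `N_E = N`, `N < 500 000` and `rank_ℤ E(ℚ) = 3` for EVERY row of the rank-3 table, the
2-descent bound `rank_ℤ ≤ 3` being asked only of the 122 residual rows. [cite: Silverman1994, IV.9.4]
[cite: Cassels1991LecturesEllipticCurves, §15] [cite: CremonaAlgorithms1997, Tables, §3.5, §3.6] -/
theorem Rank3Row.algebraicDataRank_table {r : Rank3Row} (hr : r ∈ rank3Table)
    (hup : r ∈ residualRows → r.curve.mordellWeilRank ≤ 3) :
    r.curve.IsGloballyMinimal ∧ r.curve.conductorNorm ℤ = r.N ∧ r.N < 500000 ∧ r.curve.mordellWeilRank = 3 :=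
  ⟨Rank3Row.isGloballyMinimal_of_mem hr, Rank3Row.conductorNorm_eq_of_mem hr, N_lt_of_mem hr,
    rank_eq_three_of_mem_rank3Table hr hup⟩

/-- Row `0` of the table is `5077a1` (`y² + y = x³ − 7x + 6`) and it is not a residual row (kernel). [cite: CremonaAlgorithms1997, Tables] -/
theorem rank3Table_zero_not_mem_residualRows :
    (rank3Table[0]'(by rw [rank3Table_length]; decide)) ∉ residualRows := by
  decide +kernel

/-- **Worked example (row `0`, `5077a1`, the rank-3 curve of smallest conductor in Cremona's table):** `y² + y = x³ − 7x + 6`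
is a minimal model, `N_E = 5077`, `rank_ℤ E(ℚ) = 3` EXACTLY, `#E(ℚ)_tors = 1`, `∏_v c_v = 1` — all kernel theorems, NO
hypothesis. [cite: CremonaAlgorithms1997, Tables] [cite: Cassels1991LecturesEllipticCurves, §15] -/
theorem algebraicDataRank_5077a1 :
    (rank3Table[0]'(by rw [rank3Table_length]; decide)).curve = ⟨0, 0, 1, -7, 6⟩ ∧
      (rank3Table[0]'(by rw [rank3Table_length]; decide)).curve.IsGloballyMinimal ∧
      (rank3Table[0]'(by rw [rank3Table_length]; decide)).curve.conductorNorm ℤ = 5077 ∧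
      (rank3Table[0]'(by rw [rank3Table_length]; decide)).curve.mordellWeilRank = 3 ∧
      (rank3Table[0]'(by rw [rank3Table_length]; decide)).curve.torsionOrder = 1 ∧
      (rank3Table[0]'(by rw [rank3Table_length]; decide)).curve.tamagawaProduct = 1 := by
  obtain ⟨h1, h2, h3, h4, h5⟩ :=
    Rank3Row.algebraicDataRank_getElem 0 (by rw [rank3Table_length]; decide) rank3Table_zero_not_mem_residualRows
  refine ⟨?_, h1, ?_, h3, ?_, ?_⟩
  · have h : (rank3Table[0]'(by rw [rank3Table_length]; decide)) =
        ⟨"5077a1", 0, 0, 1, -7, 6, 5077, -7, 4792, (1, 0, 1), (2, 0, 1), (0, 2, 1)⟩ := by decide +kernel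
    rw [h]; simp [Rank3Row.curve]
  · rw [h2]; decide +kernel
  · rw [h4]; decide +kernel
  · rw [h5]; decide +kernel

/-- Row `7507` (`431613a2`) is not a residual row (kernel). [cite: CremonaAlgorithms1997, Tables] -/
theorem rank3Table_7507_not_mem_residualRows :
    (rank3Table[7507]'(by rw [rank3Table_length]; decide)) ∉ residualRows := by
  decide +kernel

/-- **Worked example (row `7507`, `431613a2`), exact-rank upgrade of `algebraicData_431613a2`:** minimal, `N_E = 431613`,
`rank_ℤ = 3` EXACTLY, `#E(ℚ)_tors = 2`, `∏_v c_v = 576`. [cite: CremonaAlgorithms1997, Tables] -/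
theorem algebraicDataRank_431613a2 :
    (rank3Table[7507]'(by rw [rank3Table_length]; decide)).curve.IsGloballyMinimal ∧
      (rank3Table[7507]'(by rw [rank3Table_length]; decide)).curve.conductorNorm ℤ = 431613 ∧
      (rank3Table[7507]'(by rw [rank3Table_length]; decide)).curve.mordellWeilRank = 3 ∧
      (rank3Table[7507]'(by rw [rank3Table_length]; decide)).curve.torsionOrder = 2 ∧
      (rank3Table[7507]'(by rw [rank3Table_length]; decide)).curve.tamagawaProduct = 576 := by
  obtain ⟨h1, h2, -, h4, h5⟩ := algebraicData_431613a2
  exact ⟨h1, h2, rank_eq_three_of_not_mem_residualRows (List.getElem_mem _) rank3Table_7507_not_mem_residualRows, h4, h5⟩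

end Summit.BirchSwinnertonDyer.BirchSwinnertonDyer.Rank2Observatory
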